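import Literature.AlgebraicGeometry.Motives.JacobianBasePoint
import Literature.AlgebraicGeometry.Motives.CurvePointDivisor
import Literature.AlgebraicGeometry.Motives.CartierDivisorCurveDegree
import Literature.AlgebraicGeometry.Motives.ClosedGraphMorphism
import HarnessLib

/-!
# The Abel–Jacobi sum `aj_c(E) = ∏_P α_c(P)^{ord_P E}` of a divisor on a curve

Layer `Literature/AlgebraicGeometry/Motives`, namespace `Literature.AlgebraicGeometry.Motives.Jacobian` (dot notation on
the tree's `Motives.Jacobian C`, the Albanese-characterised Jacobian with its Abel–Jacobi maps `𝒥.abelJacobi c : C ⟶ J`,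
`x ↦ [x − c]`).  ONE light definition with body + its algebra, all proved; no named fact, no instance.

For a Cartier divisor `E` on the curve `C` (a `k`-scheme, intended smooth projective) and a rational base point `c ∈ C(k)`,
**`𝒥.ajSum c E := ∏ᶠ_{P ∈ C(k)} α_c(P)^{ord_P E} ∈ J(k)`** — the image of the Weil divisor `Σ_P ord_P(E)·P` of `E` under the
Abel–Jacobi map extended additively (written multiplicatively in Mathlib's group of `k`-points of the group scheme `J`):
Milne, *Jacobian Varieties* §2 («`f^P : C → J`, `Q ↦ [Q − P]`») and §5 («`f^r : C^r → J`, `(P₁,…,P_r) ↦ f(P₁) + ⋯ + f(P_r)`»,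
«`D ↦ f^{(r)}(D)`» on effective divisors of degree `r`); Lange, *Abelian Varieties over the Complex Numbers* §4.1.3 (the
Abel–Jacobi map on divisors, pp. 205–207, Thm. 4.1.4 p. 206, `α_c : p ↦ (p − c)` p. 207; §4.4.2 Lemma 4.4.4 (p. 224) reads it on `α_c^*(…)`).  Over an
algebraically closed field every closed point is rational, so nothing is lost by indexing over `C(k)`; `aj_c(E)` is print's
`AJ(E − deg(E)·c)`, equal to `AJ(E)` exactly when `deg E = 0`, and then independent of `c` (§4 below).  The product `∏ᶠ` has
junk value `1` on an infinite support, so the FINITENESS of the support is proved first (§1: proper `C` over an algebraically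
closed field, `CartierDivisor.finite_support_cycle` and injectivity of `AlgPoints.pt`) and every law below carries those hypotheses.

* `ajSum_eq_finset_prod` — the product is finite: over a finite set of rational points containing the support;
* `ajSum_zero`, `ajSum_add`, `ajSum_smul`, `ajSum_congr_sameDivisor` — additivity and invariance under `SameDivisor`
  (`CartierDivisor.ordAt_add`, `SameDivisor.ordAt_eq`);
* `ajSum_pointDivisor` — normalisation **`aj_c([P]) = α_c(P)`** for the prime divisor of a rational point of a smooth curve
  (`CurvePlaces.ordAt_pointDivisor`); in particular `aj_c([c]) = 1`;
* `ajSum_eq_mul_pow_of_basePoint` — change of base point: `aj_{c′}(E) = aj_c(E) · α_c(c′)^{−Σ_P ord_P E}`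
  (`abelJacobi_eq_mul_const`), so `aj` is independent of the base point on divisors of total multiplicity `0`.

Abel's theorem (`aj_c(div h) = 1`, letter (g4-1d)) and the invariance under linear equivalence (g4-1e) are NOT here (sequel file).
Use (cell `hodgecm-mathlib`, D-0151, road G4 §0 (g4-1), letters `G4.sockets` of the (F-P2) programme): the carrier in which
Lange's Cor. 4.4.5 «`(α_c^*)⁻¹ = −φ_Θ`» and eq. (4.9) are read on points.  HC_CM is proved only modulo the 7 printed citations
until rung 0 closes; this file moves no book.

## References
* [Milne1986JacobianVarieties] J. S. Milne, *Jacobian Varieties*, in Cornell–Silverman (eds.), *Arithmetic Geometry* (1986),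
  §2 (the map `f^P`), §5 (the maps `f^r`, `f^{(r)}`).
* [Lange2023AbelianVarietiesComplex] H. Lange, *Abelian Varieties over the Complex Numbers*, Grundlehren Text Editions (2023),
  §4.1.3 (pp. 205–207: the Abel–Jacobi map, Thm. 4.1.4 p. 206, `α_c` p. 207), §4.4.2 Lemma 4.4.4 (p. 224) and Cor. 4.4.5.
* [GortzWedhorn2020] U. Görtz, T. Wedhorn, *Algebraic Geometry I*, 2nd ed. (2020), (11.13.4) (the cycle map, finiteness of
  `{ord_C(D) ≠ 0}`).
-/

set_option autoImplicit false

noncomputable section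

universe u

open CategoryTheory AlgebraicGeometry

namespace Literature.AlgebraicGeometry.Motives

namespace Jacobian

open scoped MonObj

variable {k : Type u} [Field k] {C : SchemeOver k} [IsIntegral C.left] [IsLocallyNoetherian C.left] (𝒥 : Jacobian C)

/-! ## §1 The definition and its finiteness -/

/-- **`aj_c(E) = ∏_{P ∈ C(k)} α_c(P)^{ord_P E}`** — the Abel–Jacobi sum of a Cartier divisor `E` on the curve `C` with base point
`c ∈ C(k)`: the (finite) product over the rational points `P` of `C` of the `k`-points `α_c(P) = [P − c] ∈ J(k)` raised to the
multiplicity `ord_P E` (Milne JV §5 «`D ↦ f(P₁) + ⋯ + f(P_r)`», written multiplicatively in the group of `k`-points of `J`).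
[cite: Milne1986JacobianVarieties, §5 (the maps f^r : C^r → J)] [cite: Lange2023AbelianVarietiesComplex, §4.1.3 (pp. 205–207, the Abel–Jacobi map, Thm. 4.1.4 p. 206; α_c p. 207)] -/
def ajSum (c : AlgPoints C k) (E : CartierDivisor C.left) : 𝒥.J.Points k :=
  ∏ᶠ P : AlgPoints C k, (AlgPoints.map (𝒥.abelJacobi c) P) ^ (E.ordAt P.pt)

section Finite

variable [IsAlgClosed k] [IsProper C.hom]

/-- Over an algebraically closed field the rational points of the proper curve at which a Cartier divisor has non-zero
multiplicity form a finite set (the support of its Weil cycle is finite, `CartierDivisor.finite_support_cycle`, and a rational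
point is determined by its underlying point). [cite: GortzWedhorn2020, (11.13.4)] -/
theorem finite_setOf_ordAt_pt_ne_zero (E : CartierDivisor C.left) :
    {P : AlgPoints C k | E.ordAt P.pt ≠ 0}.Finite := by
  have hfin := E.finite_support_cycle (C := C)
  refine (hfin.preimage (f := fun P : AlgPoints C k => P.pt) ?_).subset ?_
  · exact fun P _ Q _ h => AlgPoints.eq_of_pt_eq h
  · intro P hP
    simpa [Function.mem_support, CartierDivisor.cycle_apply] using hP

/-- The multiplicative support of the factors of `aj_c(E)` is finite. [cite: GortzWedhorn2020, (11.13.4)] -/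
theorem finite_mulSupport_ajSum (c : AlgPoints C k) (E : CartierDivisor C.left) :
    (Function.mulSupport fun P : AlgPoints C k => (AlgPoints.map (𝒥.abelJacobi c) P) ^ (E.ordAt P.pt)).Finite := by
  refine (finite_setOf_ordAt_pt_ne_zero (C := C) E).subset ?_
  intro P hP
  simp only [Function.mem_mulSupport] at hP
  simp only [Set.mem_setOf_eq]
  intro h0
  exact hP (by rw [h0, zpow_zero])

end Finite

/-- **`aj_c(E)` as a finite product**: over any finite set of rational points containing those with `ord_P E ≠ 0`.
[cite: Milne1986JacobianVarieties, §5 (the maps f^r)] -/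
theorem ajSum_eq_finset_prod (c : AlgPoints C k) (E : CartierDivisor C.left) (s : Finset (AlgPoints C k))
    (hs : ∀ P : AlgPoints C k, E.ordAt P.pt ≠ 0 → P ∈ s) :
    𝒥.ajSum c E = ∏ P ∈ s, (AlgPoints.map (𝒥.abelJacobi c) P) ^ (E.ordAt P.pt) := by
  classical
  unfold ajSum
  apply finprod_eq_prod_of_mulSupport_subset
  intro P hP
  simp only [Function.mem_mulSupport] at hP
  refine Finset.mem_coe.mpr (hs P ?_)
  intro h0
  exact hP (by rw [h0, zpow_zero])

/-! ## §2 Additivity -/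

/-- `aj_c(0) = 1`. [cite: Milne1986JacobianVarieties, §5 (the maps f^r)] -/
theorem ajSum_zero (c : AlgPoints C k) : 𝒥.ajSum c 0 = 1 := by
  unfold ajSum
  simp only [CartierDivisor.ordAt_zero, zpow_zero, finprod_one]

section Add

variable [IsAlgClosed k] [IsProper C.hom]

/-- **`aj_c(E + F) = aj_c(E) · aj_c(F)`** (`ord_P(E + F) = ord_P E + ord_P F`). [cite: Milne1986JacobianVarieties, §5 (the maps f^r)] -/
theorem ajSum_add (c : AlgPoints C k) (E F : CartierDivisor C.left) :
    𝒥.ajSum c (E + F) = 𝒥.ajSum c E * 𝒥.ajSum c F := by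
  unfold ajSum
  rw [← finprod_mul_distrib (𝒥.finite_mulSupport_ajSum c E) (𝒥.finite_mulSupport_ajSum c F)]
  refine finprod_congr fun P => ?_
  rw [CartierDivisor.ordAt_add, zpow_add]

/-- `aj_c(n • E) = aj_c(E)^n`. [cite: Milne1986JacobianVarieties, §5 (the maps f^r)] -/
theorem ajSum_smul (c : AlgPoints C k) (n : ℕ) (E : CartierDivisor C.left) :
    𝒥.ajSum c (n • E) = 𝒥.ajSum c E ^ n := by
  unfold ajSum
  rw [finprod_pow (𝒥.finite_mulSupport_ajSum c E)]
  refine finprod_congr fun P => ?_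
  rw [CartierDivisor.ordAt_smul, mul_comm, zpow_mul, zpow_natCast]

end Add

/-- **`aj_c` only depends on the divisor**: `SameDivisor` divisors have the same multiplicities. [cite: Milne1986JacobianVarieties, §5 (the maps f^r)] -/
theorem ajSum_congr_sameDivisor (c : AlgPoints C k) {E F : CartierDivisor C.left} (h : E.SameDivisor F) :
    𝒥.ajSum c E = 𝒥.ajSum c F := by
  unfold ajSum
  refine finprod_congr fun P => ?_
  rw [h.ordAt_eq]

/-! ## §3 Normalisation: the prime divisor of a rational point -/

section Point

variable [IsAlgClosed k] [LocallyOfFiniteType C.hom] [SmoothOfRelativeDimension 1 C.hom]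

/-- **`aj_c([P]) = α_c(P)`** for the prime divisor `[P]` of a rational point of the smooth curve `C` (its multiplicity is `1`
at `P` and `0` elsewhere, `CurvePlaces.ordAt_pointDivisor`; rational points with the same underlying point are equal).
[cite: Milne1986JacobianVarieties, §2 (the map f^P, Q ↦ [Q − P])] -/
theorem ajSum_pointDivisor (c P : AlgPoints C k) (hP : P.pt ≠ genericPoint C.left) :
    𝒥.ajSum c (CurvePlaces.pointDivisor C hP) = AlgPoints.map (𝒥.abelJacobi c) P := by
  classical
  unfold ajSum
  rw [finprod_eq_single _ P]
  · rw [CurvePlaces.ordAt_pointDivisor_self hP, zpow_one]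
  · intro Q hQ
    have hne : Q.pt ≠ P.pt := fun h => hQ (AlgPoints.eq_of_pt_eq h)
    rw [CurvePlaces.ordAt_pointDivisor_of_ne hP hne, zpow_zero]

/-- In particular `aj_c([c]) = 1` (`α_c(c) = 0`). [cite: Milne1986JacobianVarieties, §2 (f^P(P) = 0)] -/
theorem ajSum_pointDivisor_self (c : AlgPoints C k) (hc : c.pt ≠ genericPoint C.left) :
    𝒥.ajSum c (CurvePlaces.pointDivisor C hc) = 1 := by
  rw [ajSum_pointDivisor, AlgPoints.map_apply, point_comp_abelJacobi]

end Point

/-! ## §4 Change of base point -/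

section BasePoint

/-- `∏_{i ∈ s} a^{f i} = a^{Σ_{i ∈ s} f i}` for integer exponents in a commutative group. [folklore] -/
private theorem prod_zpow_eq_zpow_sum {G : Type*} [CommGroup G] {α : Type*} (s : Finset α) (f : α → ℤ) (a : G) :
    ∏ i ∈ s, a ^ f i = a ^ ∑ i ∈ s, f i := by
  classical
  induction s using Finset.induction_on with
  | empty => simp
  | insert i s hi ih => rw [Finset.prod_insert hi, Finset.sum_insert hi, ih, zpow_add]

/-- **Change of base point**: `aj_{c′}(E) = aj_c(E) · α_c(c′)^{−Σ_P ord_P E}` — each factor changes by the constant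
`[c − c′] = α_c(c′)⁻¹` (`abelJacobi_eq_mul_const`), so on divisors of total multiplicity `0` the Abel–Jacobi sum does not
depend on the base point. [cite: Milne1986JacobianVarieties, §2 (f^{P'} = f^P composed with a translation)] -/
theorem ajSum_eq_mul_pow_of_basePoint (c c' : AlgPoints C k) (E : CartierDivisor C.left) (s : Finset (AlgPoints C k))
    (hs : ∀ P : AlgPoints C k, E.ordAt P.pt ≠ 0 → P ∈ s) :
    𝒥.ajSum c' E = 𝒥.ajSum c E * ((AlgPoints.map (𝒥.abelJacobi c) c')⁻¹) ^ (∑ P ∈ s, E.ordAt P.pt) := by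
  classical
  rw [𝒥.ajSum_eq_finset_prod c' E s hs, 𝒥.ajSum_eq_finset_prod c E s hs, ← prod_zpow_eq_zpow_sum,
    ← Finset.prod_mul_distrib]
  refine Finset.prod_congr rfl fun P _ => ?_
  rw [← mul_zpow]
  congr 1
  rw [AlgPoints.map_apply, AlgPoints.map_apply, AlgPoints.map_apply, 𝒥.abelJacobi_eq_mul_const c c',
    MonObj.comp_mul]
  congr 1
  rw [← Category.assoc, point_comp_toSpecOver, Category.id_comp]

/-- Hence, if the multiplicities of `E` at the rational points sum to `0`, `aj_c(E)` is independent of `c`.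
[cite: Milne1986JacobianVarieties, §2 (f^{P'} = f^P composed with a translation)] -/
theorem ajSum_eq_of_sum_ordAt_eq_zero (c c' : AlgPoints C k) (E : CartierDivisor C.left) (s : Finset (AlgPoints C k))
    (hs : ∀ P : AlgPoints C k, E.ordAt P.pt ≠ 0 → P ∈ s) (h0 : ∑ P ∈ s, E.ordAt P.pt = 0) :
    𝒥.ajSum c' E = 𝒥.ajSum c E := by
  rw [𝒥.ajSum_eq_mul_pow_of_basePoint c c' E s hs, h0, zpow_zero, mul_one]

end BasePoint

end Jacobian

end Literature.AlgebraicGeometry.Motives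

end
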